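import HarnessLib
import Summits.Ventures.WeilGRH.SechTablesA1

/-!
# Window `a = 1`: the kernel-checked DIAGONAL `sech` table, part C (modes `14 ≤ n < 17`, `K = 512`)

Cell `rh-explicit`, WEIL TRACK — GRH ARM (engine seat weil-grh-2 gen14).  Continuation of `SechTablesA1`: the diagonal table `SechTablesA1.dtabA1`
(boxes of `sechIncrCoeff a n n` at `a = 1`, scale `2^256`) validated IN THE KERNEL by `checkDiagTabH` on the modes `14 ≤ n < 17` (range lemma
`hdtA1c`; the door-CO / door-H cells glue the ranges they need: block `B` needs the modes `n < B`).  Parts B–E import part A only, so they can be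
filed independently of each other.  Everything is PROVED; RH/GRH-free; standard axioms.
-/

set_option linter.style.longLine false

noncomputable section

namespace Summit.Ventures.WeilGRH.SechTablesA1
open Literature.NumberTheory.LFunctions Literature.NumberTheory.LFunctions.Yoshida1992 Encl
open Literature.Analysis.ValidatedNumerics.NumericsMP Literature.Analysis.SpecialFunctions
open Summit.RiemannHypothesis.RiemannHypothesis.Theorems.WeilFormatCData.A1
open Summit.Ventures.WeilGRH.TwistedEncl Summit.Ventures.WeilGRH.SechEncl
open scoped Real

set_option maxRecDepth 200000 in
/-- the diagonal table is the kernel's on `14 ≤ n < 17` (`K = 512` + half term). [folklore] -/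
theorem tDA1c : checkDiagTabH (2 ^ 256) 128 P A EAA1 E0A1 RA1 512 14 17 dtabA1 = true := by
  set_option maxHeartbeats 0 in decide +kernel
/-- the diagonal table is valid on `14 ≤ n < 17`. [folklore] -/
theorem hdtA1c : ∀ n : ℕ, 14 ≤ n → n < 17 → MI.mem (2 ^ 256) (sechIncrCoeff a n n) (dtabA1.getD n default) :=
  diagTabValid_of_checkH (by positivity) a_pos pi_mem a_mem hEAA1 hE0A1 hRA1 tDA1c

end Summit.Ventures.WeilGRH.SechTablesA1

end
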